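import Summits.HodgeConjecture.HodgeConjecture.Theorems.R90S4PlainWeylMeasure   -- ★ p863297 (this seat): `IsPlainWeylMeasure` (+ the LH6 Weyl tower: ★ CARTAN-ALL, (E1b), (E2b), (E3), (J6), JAC-ELL C8, `exists_weylElt`, `continuous_vanDijkWeight`, `continuous_sqrt_dgRadicand`)
import HarnessLib

/-!
# R90-TF · S4 «Ch. 13.1–2», brick (B2-N) — THE CARTAN MEASURES AS NAMED TERMS: `plainCartanMeasure C tT` (print's `Σ_T |Ω(T,G)|⁻¹ (ι_T)_*(D_G² dγ_T)`, §12.5 p. 182)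
# and `stableCartanMeasure C tT n` (the same reweighted by `n(γ)⁻¹`, `n(γ)` = number of classes in the stable class), with the plain Weyl formula PROVED for the named term

Cell `hodgecm-mathlib`, crux H413 (`stmt-HodgeConjecture-24833`, lane `--supports … --as helper`), route of record `HCCMUnconditional` (no route verbs;
count-neutral).  Programme R90-TF, section S4, dealer K2E2-plan (g7): RULING S4-R25 (2) «NAMED CARTAN MEASURES (option (ii), realised in Theorems)», DEALT BY NAME
(`R90/STATUS.md` 2026-09-05T00:21:31Z; DEF signatures posted 00:22Z); seat K2E3-p12 (g10).  WHY NAMED TERMS (S4-R25): ★ `IsStableWeylMeasure` / ★ `IsTwistedWeylMeasure` see a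
measure only through its push-forward to STABLE classes, so a «`∀ ρ, S-WIF ρ → T-WIF ρ`» socket would smuggle a push-forward-uniqueness lemma; with `ρ` a NAMED TERM the three (W-NP)
conjuncts are stated on the same object and no uniqueness is needed.  THIS FILE re-packages ★ p863297 `exists_isPlainWeylMeasure` (∃-only; its `ρ₀` lived inside the proof) with the
chosen data — the Cartan system `C` and the torus measures `tT` — as ARGUMENTS: THREE definitions (`cartanWeight`, `plainCartanMeasure`, `stableCartanMeasure`, review lane) + the
plain Weyl formula for the named term + the ★ existential re-derived.  ★-only imports (the ★ file is NOT touched); no instance, no notation, no `sorry`.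

## CONTENTS (`G_v = Gqs L v = U(Φ₃)(L⁺_v)`, `v` non-split for the theorem)
* §1 `cartanWeight L v T : ↥T → ℝ≥0` — the Weyl weight on a member `T` of the Cartan system: `(Re Δ)²` on the split Cartan `M` (★ (J6)), the letter `√(∏_w |disc χ_t|_w (∏_w |det t|_w)⁻²)`
  on the others (★ JAC-ELL C8) — ★ p863297's `D i` verbatim; `cartanWeight_of_eq`, `cartanWeight_of_ne`, `measurable_cartanWeight`.
* §2 `plainCartanMeasure L v C tT := Σ_{T ∈ C} [N(T):T]⁻¹ • (ι_T)_*((tT T)|_{T^{reg}} · cartanWeight T)` and **`isPlainWeylMeasure_plainCartanMeasure`**: for a Cartan system `C`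
  with the four letters of ★ `exists_cartanAll_weylShape` (`hZ`, `hcpt`, `hcov`, `hirr`) and torus measures `tT` with the three letters of ★ `exists_haar_cartan_compactCore_eq_one`
  (Haar, inversion invariant, mass one on the compact core), and `mG` canonical for the Haar measure `νG`:
  `IsPlainWeylMeasure L (splitFormGL L) v νG mG (plainCartanMeasure L v C tT)` and the measure is carried by the regular set (proof = ★ p863297's, with the choices as binders).
* §3 `stableCartanMeasure L v C tT n := (plainCartanMeasure L v C tT).withDensity (n⁻¹)` — the term on which the (B2-S) head (`R90S4StableRegroupOfPlain`, next) proves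
  ★ `IsStableWeylMeasure` from the stable-transport dictionary, and on which p03's T-WIF head is to be stated (S4-R25 (3)); `stableCartanMeasure_absolutelyContinuous`.
* §4 `exists_cartanData_isPlainWeylMeasure` — the data exist (★ CARTAN-ALL + ★ (E3)), so ★ `exists_isPlainWeylMeasure`'s statement follows from §2.

HONEST LABEL: HC_CM is proved only modulo the 7 printed citations (2 remaining named inputs: hLiu418 = stmt-HodgeConjecture-24832, h413 = stmt-HodgeConjecture-24833) until rung 0
closes.  Unconditional re-packaging; discharges no named input ((W-NP) ∕ (1D-CT)_ns OPEN).  REL ≠ ★ ≠ BUILT.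

## References
* [Rogawski1990] J. D. Rogawski, *Automorphic Representations of Unitary Groups in Three Variables*, Ann. of Math. Stud. 123 (1990), §12.5 p. 182; §4.3 (4.3.1) p. 43; §3.6 pp. 28–31.
* [HarishChandra1970] Harish-Chandra (notes by G. van Dijk), *Harmonic analysis on reductive p-adic groups*, LNM 162 (1970), Lemmas 22, 42.
-/

set_option autoImplicit false
set_option linter.dupNamespace false

noncomputable section

open MeasureTheory Measure Set Filter Topology Function NumberField IsDedekindDomain
open Literature.MeasureTheory.Group
open Literature.NumberTheory.Automorphic Literature.NumberTheory.Automorphic.UnitaryGroup Literature.NumberTheory.Rogawski1990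
open Summit.HodgeConjecture.HodgeConjecture.Cruxes.H413
open Summit.HodgeConjecture.HodgeConjecture.Cruxes.H413.F0P3cStCharTSWeylCartanRadial
open Summit.HodgeConjecture.HodgeConjecture.Cruxes.H413.F0P3cStCharTSWeylCartanJacobian
open Summit.HodgeConjecture.HodgeConjecture.Cruxes.H413.F0P3cStCharTSWeylCartanOrbInt
open Summit.HodgeConjecture.HodgeConjecture.Cruxes.H413.F0P3cStCharTSWeylCartanWIF
open Summit.HodgeConjecture.HodgeConjecture.Cruxes.H413.F0P3cStCharTSWeylHypMeasure
open Summit.HodgeConjecture.HodgeConjecture.Cruxes.H413.F0P3cStCharTSWeylHypJacobianCartanM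
open scoped ENNReal NNReal MatrixGroups Pointwise

namespace Summit.HodgeConjecture.HodgeConjecture.R90.S4

section CartanMeasures

variable (L : Type) [Field L] [NumberField L] [IsCMField L] (v : HeightOneSpectrum (𝓞 ↥(maximalRealSubfield L)))

/-! ## §1 The Weyl weight on a member of the Cartan system -/

open scoped Classical in
/-- **The Weyl weight `D_T = D_G²|_T` on a member `T` of the Cartan system of `U(Φ₃)(L⁺_v)`**, in the currency of the ★ tube-Jacobian lemmas: on the split Cartan `M` the square
`(Re Δ(t))²` of the van Dijk weight (★ (J6) `tubeJacobianLocal_cartan_Gqs_vanDijkWeight_sq`), on every other member the letter `√(∏_w |disc χ_t|_w · (∏_w |det t|_w)⁻²)` (★ JAC-ELL C8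
`tubeJacobianSocket_compactCartan`) — the `D i` of ★ p863297 `exists_isPlainWeylMeasure`, made a named function (classical `if` on `T = M`).
[cite: Rogawski1990, §12.5 p. 182; §4.9 p. 54] [cite: HarishChandra1970, Lemma 22] -/
def cartanWeight (T : Subgroup (Gqs L v)) (t : ↥T) : ℝ≥0 :=
  if h : T = (cmBorelTriple L 3 v).M then
    Real.toNNReal ((F0P3cStCharTSTorusDefs.vanDijkWeight L v ⟨(t : Gqs L v), h ▸ t.2⟩).re ^ 2)
  else NNReal.sqrt
    ((∏ w' : PlacesOver L v, Literature.NumberTheory.GaloisRepresentations.IsNonarchimedeanLocalField.normAbs (w'.1.adicCompletion L)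
        ((((t : Gqs L v).val : GL (Fin 3) (UnitaryGroup.LocalRing L v)).val.charpoly.discr) w')) *
      ((∏ w' : PlacesOver L v, Literature.NumberTheory.GaloisRepresentations.IsNonarchimedeanLocalField.normAbs (w'.1.adicCompletion L)
        ((((t : Gqs L v).val : GL (Fin 3) (UnitaryGroup.LocalRing L v)).val.det) w')) ^ 2)⁻¹)

open scoped Classical in
/-- On the split Cartan `M`: `cartanWeight M t = (Re Δ(t))²`. [cite: Rogawski1990, §12.5 p. 182] -/
theorem cartanWeight_of_eq {T : Subgroup (Gqs L v)} (h : T = (cmBorelTriple L 3 v).M) :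
    cartanWeight L v T = fun t : ↥T => Real.toNNReal ((F0P3cStCharTSTorusDefs.vanDijkWeight L v ⟨(t : Gqs L v), h ▸ t.2⟩).re ^ 2) :=
  funext fun _ => dif_pos h

open scoped Classical in
/-- Off the split Cartan: `cartanWeight T t = √(∏_w |disc χ_t|_w (∏_w |det t|_w)⁻²)`. [cite: Rogawski1990, §12.5 p. 182; §4.9 p. 54] -/
theorem cartanWeight_of_ne {T : Subgroup (Gqs L v)} (h : T ≠ (cmBorelTriple L 3 v).M) :
    cartanWeight L v T = fun t : ↥T => NNReal.sqrt
      ((∏ w' : PlacesOver L v, Literature.NumberTheory.GaloisRepresentations.IsNonarchimedeanLocalField.normAbs (w'.1.adicCompletion L)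
          ((((t : Gqs L v).val : GL (Fin 3) (UnitaryGroup.LocalRing L v)).val.charpoly.discr) w')) *
        ((∏ w' : PlacesOver L v, Literature.NumberTheory.GaloisRepresentations.IsNonarchimedeanLocalField.normAbs (w'.1.adicCompletion L)
          ((((t : Gqs L v).val : GL (Fin 3) (UnitaryGroup.LocalRing L v)).val.det) w')) ^ 2)⁻¹) :=
  funext fun _ => dif_neg h

/-- The Weyl weight is measurable (`v` non-split: ★ `measurable_vanDijkWeight` on `M`, ★ `continuous_sqrt_dgRadicand` elsewhere). [cite: Rogawski1990, §12.5 p. 182] -/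
theorem measurable_cartanWeight (hns : ∀ w : PlacesOver L v, IsCMField.complexConj L • w.1 = w.1)
    [MeasurableSpace (Gqs L v)] [BorelSpace (Gqs L v)] (T : Subgroup (Gqs L v)) : Measurable (cartanWeight L v T) := by
  -- the matrix carrier `U(Φ₃)(L⁺_v)` IS `Gqs L v`: hand it the σ-algebra (as ★ (J6) does), so that `↥M` is a measurable subtype
  letI hmsU : MeasurableSpace ↥(unitaryGroupOfForm (conjLocal L (IsCMField.complexConj L) v) (cmLocalForm L 3 v)) := ‹MeasurableSpace (Gqs L v)›
  haveI hbU : BorelSpace ↥(unitaryGroupOfForm (conjLocal L (IsCMField.complexConj L) v) (cmLocalForm L 3 v)) := ⟨BorelSpace.measurable_eq (α := Gqs L v)⟩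
  by_cases h : T = (cmBorelTriple L 3 v).M
  · rw [cartanWeight_of_eq L v h]
    have hmk : Measurable fun t : ↥T => (⟨(t : Gqs L v), h ▸ t.2⟩ : ↥(cmBorelTriple L 3 v).M) := measurable_subtype_coe.subtype_mk
    exact (continuous_real_toNNReal.measurable.comp
      ((Complex.continuous_re.measurable.comp (F0P3cStCharTSVanDijkCore.measurable_vanDijkWeight L v hns)).pow_const 2)).comp hmk
  · rw [cartanWeight_of_ne L v h]
    exact (F0P3cStCharTSWeylDatumPinsWIF.continuous_sqrt_dgRadicand L v).measurable.comp measurable_subtype_coe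

/-! ## §2 The plain Cartan measure and the plain Weyl formula for it -/

/-- **THE PLAIN CARTAN MEASURE `ρ₀(C, tT) = Σ_{T ∈ C} [N(T):T]⁻¹ • (ι_T)_*((tT T)|_{T^{reg}} · D_T)`** — print's torus side `Σ_T |Ω(T,G)|⁻¹ ∫_T D_G(γ)² (·) dγ` (p. 182 first display) as ONE
measure on `G_v`: for each member `T` of the Cartan system `C`, the torus measure `tT T` restricted to the regular elements of `T`, weighted by `D_T` (`cartanWeight`), pushed forward along
`T ↪ G_v`, and weighted by `|Ω(T,G)|⁻¹ = [N(T):T]⁻¹`.  The `ρ₀` of ★ p863297 `exists_isPlainWeylMeasure` with its data as arguments. [cite: Rogawski1990, §12.5 p. 182; §4.3 (4.3.1) p. 43] -/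
def plainCartanMeasure [MeasurableSpace (Gqs L v)] (C : Finset (Subgroup (Gqs L v))) (tT : ∀ i : ↥C, Measure ↥(i : Subgroup (Gqs L v))) : Measure (Gqs L v) :=
  ∑ i : ↥C, ((((i : Subgroup (Gqs L v)).subgroupOf (Subgroup.normalizer ((i : Subgroup (Gqs L v)) : Set (Gqs L v)))).index : ℝ≥0))⁻¹ •
    Measure.map ((↑) : ↥(i : Subgroup (Gqs L v)) → Gqs L v)
      (((tT i).restrict {t : ↥(i : Subgroup (Gqs L v)) | IsRegularElt (((t : Gqs L v)).val : GL (Fin 3) (LocalRing L v))}).withDensity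
        fun t => (cartanWeight L v (i : Subgroup (Gqs L v)) t : ℝ≥0∞))

/-- Unfolding of `plainCartanMeasure` (`rfl`). [cite: Rogawski1990, §12.5 p. 182] -/
theorem plainCartanMeasure_def [MeasurableSpace (Gqs L v)] (C : Finset (Subgroup (Gqs L v))) (tT : ∀ i : ↥C, Measure ↥(i : Subgroup (Gqs L v))) :
    plainCartanMeasure L v C tT =
      ∑ i : ↥C, ((((i : Subgroup (Gqs L v)).subgroupOf (Subgroup.normalizer ((i : Subgroup (Gqs L v)) : Set (Gqs L v)))).index : ℝ≥0))⁻¹ •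
        Measure.map ((↑) : ↥(i : Subgroup (Gqs L v)) → Gqs L v)
          (((tT i).restrict {t : ↥(i : Subgroup (Gqs L v)) | IsRegularElt (((t : Gqs L v)).val : GL (Fin 3) (LocalRing L v))}).withDensity
            fun t => (cartanWeight L v (i : Subgroup (Gqs L v)) t : ℝ≥0∞)) := rfl

/-- **THE PLAIN WEYL FORMULA FOR THE NAMED MEASURE** (`v` non-split).  Let `C` be a Cartan system of `U(Φ₃)(L⁺_v)` — every member is `Z(γ₀)` with `γ₀` regular (`hZ`), the members `≠ M` are
compact (`hcpt`), every regular centraliser is conjugate into a member (`hcov`), distinct members are not conjugate (`hirr`): the four conjuncts of ★ `exists_cartanAll_weylShape` — and let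
`tT` give on each member a Haar measure, inversion invariant, of mass one on the compact core (the three conjuncts of ★ `exists_haar_cartan_compactCore_eq_one`).  Then for every Haar
measure `νG` and every orbital family `mG` canonical for `νG`: **`IsPlainWeylMeasure L (splitFormGL L) v νG mG (plainCartanMeasure L v C tT)`** and the measure is carried by the regular
set.  Proof = ★ p863297's: ★ (E2b) `integral_mul_classFun_eq_sum_classOrbitalIntegral_of_tubeJacobians` fed with ★ (J6) at `M` and ★ JAC-ELL C8 elsewhere, per-torus integrability from
★ (E1b), then `integral_finsetSum_measure` ∕ `MeasurableEmbedding.integral_map` ∕ `integral_withDensity_eq_integral_smul`. [cite: Rogawski1990, §12.5 p. 182; §4.3 (4.3.1) p. 43]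
[cite: HarishChandra1970, Lemma 22; Lemma 42] -/
theorem isPlainWeylMeasure_plainCartanMeasure (hns : ∀ w : PlacesOver L v, IsCMField.complexConj L • w.1 = w.1)
    [MeasurableSpace (Gqs L v)] [BorelSpace (Gqs L v)]
    [∀ γ' : Gqs L v, MeasurableSpace (Gqs L v ⧸ Subgroup.centralizer ({γ'} : Set (Gqs L v)))]
    [∀ γ' : Gqs L v, BorelSpace (Gqs L v ⧸ Subgroup.centralizer ({γ'} : Set (Gqs L v)))]
    {C : Finset (Subgroup (Gqs L v))}
    (hZ : ∀ T ∈ C, ∃ γ₀ : Gqs L v, IsRegularElt (γ₀.val : GL (Fin 3) (LocalRing L v)) ∧ T = Subgroup.centralizer ({γ₀} : Set (Gqs L v)))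
    (hcpt : ∀ T ∈ C, T ≠ (cmBorelTriple L 3 v).M → IsCompact (T : Set (Gqs L v)))
    (hcov : ∀ γ : Gqs L v, IsRegularElt (γ.val : GL (Fin 3) (LocalRing L v)) →
      ∃ T ∈ C, ∃ x : Gqs L v, ∀ g : Gqs L v, g ∈ Subgroup.centralizer ({γ} : Set (Gqs L v)) ↔ x⁻¹ * g * x ∈ T)
    (hirr : ∀ T ∈ C, ∀ T' ∈ C, T ≠ T' → ∀ y : Gqs L v, ¬ ∀ h : Gqs L v, h ∈ T' ↔ y⁻¹ * h * y ∈ T)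
    (νG : Measure (Gqs L v)) [νG.IsHaarMeasure] [νG.IsMulRightInvariant]
    (mG : OrbitalMeasureFamily (Gqs L v)) (hcan : mG.IsCanonical (fun γ : Gqs L v => IsRegularElt (γ.val : GL (Fin 3) (LocalRing L v))) νG)
    (tT : ∀ i : ↥C, Measure ↥(i : Subgroup (Gqs L v))) (htH : ∀ i : ↥C, (tT i).IsHaarMeasure) (htI : ∀ i : ↥C, (tT i).IsInvInvariant)
    (htc : ∀ i : ↥C, tT i (compactCore ↥(i : Subgroup (Gqs L v))) = 1) :
    IsPlainWeylMeasure L (R90.S4.splitFormGL L) v νG mG (plainCartanMeasure L v C tT) ∧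
      ∀ᵐ γ ∂(plainCartanMeasure L v C tT), IsRegularElt (γ.val : GL (Fin 3) (LocalRing L v)) := by
  classical
  obtain ⟨w⟩ := (inferInstance : Nonempty (PlacesOver L v))
  -- ### (1) the regular generators and the conjugation charts
  choose γ₀ hγ₀ hTeq using hZ
  have hab : ∀ i : ↥C, ∀ a ∈ (i : Subgroup (Gqs L v)), ∀ b ∈ (i : Subgroup (Gqs L v)), a * b = b * a := by
    intro i a ha b hb
    rw [hTeq i i.2] at ha hb
    exact mul_comm_of_mem_centralizer L v (hγ₀ i i.2) a ha b hb
  choose Φc hΦc using fun i : ↥C => exists_conjFamily (i : Subgroup (Gqs L v)) (hab i)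
  haveI hH : ∀ i : ↥C, (tT i).IsHaarMeasure := htH
  haveI hI : ∀ i : ↥C, (tT i).IsInvInvariant := htI
  letI hmsQ : ∀ i : ↥C, MeasurableSpace (Gqs L v ⧸ (i : Subgroup (Gqs L v))) := fun _ => borel _
  haveI hbQ : ∀ i : ↥C, BorelSpace (Gqs L v ⧸ (i : Subgroup (Gqs L v))) := fun _ => ⟨rfl⟩
  -- ### (2) the weights
  let DM : ↥(cmBorelTriple L 3 v).M → ℝ≥0 := fun t => Real.toNNReal ((F0P3cStCharTSTorusDefs.vanDijkWeight L v t).re ^ 2)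
  have hDM : ∀ t : ↥(cmBorelTriple L 3 v).M, (DM t : ℝ) = ((F0P3cStCharTSTorusDefs.vanDijkWeight L v t).re) ^ 2 :=
    fun t => Real.coe_toNNReal _ (sq_nonneg _)
  let D : ∀ i : ↥C, ↥(i : Subgroup (Gqs L v)) → ℝ≥0 := fun i => cartanWeight L v (i : Subgroup (Gqs L v))
  have hD : ∀ i : ↥C, Measurable (D i) := fun i => measurable_cartanWeight L v hns (i : Subgroup (Gqs L v))
  -- ### (3) the tube Jacobians: ★ (J6) at `M`, ★ JAC-ELL C8 at the compact members
  obtain ⟨w₀, hw₀⟩ := F0P3cStCharTSVanDijkWeylSymm.exists_weylElt L v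
  have hJac : ∀ i : ↥C, ∀ t₀ : ↥(i : Subgroup (Gqs L v)), IsRegularElt (((t₀ : Gqs L v)).val : GL (Fin 3) (LocalRing L v)) →
      ∃ U : Set ↥(i : Subgroup (Gqs L v)), IsOpen U ∧ t₀ ∈ U ∧
        ∃ A₀ : Set (Gqs L v ⧸ (i : Subgroup (Gqs L v))), MeasurableSet A₀ ∧
          (quotientMeasure (i : Subgroup (Gqs L v)) (tT i) (isClosed_cartan (hTeq i i.2)) νG) A₀ ≠ 0 ∧
          (quotientMeasure (i : Subgroup (Gqs L v)) (tT i) (isClosed_cartan (hTeq i i.2)) νG) A₀ ≠ ∞ ∧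
          ∀ V : Set ↥(i : Subgroup (Gqs L v)), MeasurableSet V → V ⊆ U →
            (∀ t ∈ V, IsRegularElt (((t : Gqs L v)).val : GL (Fin 3) (LocalRing L v))) →
            (∀ n : Gqs L v, n ∉ (i : Subgroup (Gqs L v)) → ∀ t ∈ V, ∀ t' ∈ V, ((t' : ↥(i : Subgroup (Gqs L v))) : Gqs L v) ≠ n * t * n⁻¹) →
              νG (Φc i '' (A₀ ×ˢ V)) = (quotientMeasure (i : Subgroup (Gqs L v)) (tT i) (isClosed_cartan (hTeq i i.2)) νG) A₀ *
                ∫⁻ t in V, (D i t : ℝ≥0∞) ∂(tT i) := by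
    intro i t₀ ht₀
    by_cases h : (i : Subgroup (Gqs L v)) = (cmBorelTriple L 3 v).M
    · show ∃ U, IsOpen U ∧ t₀ ∈ U ∧ ∃ A₀, MeasurableSet A₀ ∧ _ ∧ _ ∧ ∀ V, MeasurableSet V → V ⊆ U → _ → _ →
        νG (Φc i '' (A₀ ×ˢ V)) = _ * ∫⁻ t in V, (cartanWeight L v (i : Subgroup (Gqs L v)) t : ℝ≥0∞) ∂(tT i)
      rw [cartanWeight_of_eq L v h]
      exact tubeJacobianLocal_cartan_Gqs_vanDijkWeight_sq L v hns νG h (isClosed_cartan (hTeq i i.2)) (Φc i) (hΦc i) (tT i) (htc i) w₀ hw₀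
        DM (fun t : ↥(i : Subgroup (Gqs L v)) => DM ⟨(t : Gqs L v), h ▸ t.2⟩) (fun t t' htt' => congrArg DM (Subtype.ext htt')) hDM t₀ ht₀
    · show ∃ U, IsOpen U ∧ t₀ ∈ U ∧ ∃ A₀, MeasurableSet A₀ ∧ _ ∧ _ ∧ ∀ V, MeasurableSet V → V ⊆ U → _ → _ →
        νG (Φc i '' (A₀ ×ˢ V)) = _ * ∫⁻ t in V, (cartanWeight L v (i : Subgroup (Gqs L v)) t : ℝ≥0∞) ∂(tT i)
      rw [cartanWeight_of_ne L v h]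
      obtain ⟨U, hUo, ht₀U, A₀, hA₀m, hA₀0, hA₀top, hJ⟩ :=
        F0P3cStCharTSJacCartanTerminus.tubeJacobianSocket_compactCartan L v hns νG (i : Subgroup (Gqs L v)) (γ₀ i i.2) (hγ₀ i i.2) (hTeq i i.2)
          (hcpt i i.2 h) (tT i) (hH i) (hI i) (htc i) t₀ ht₀
      refine ⟨U, hUo, ht₀U, A₀, hA₀m, hA₀0, hA₀top, fun V hVm hVU hVreg hVW => ?_⟩
      have htube : Φc i '' (A₀ ×ˢ V) = {y : Gqs L v | ∃ (x : Gqs L v) (t : ↥(i : Subgroup (Gqs L v))),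
          (QuotientGroup.mk x : Gqs L v ⧸ (i : Subgroup (Gqs L v))) ∈ A₀ ∧ t ∈ V ∧ y = x * t * x⁻¹} := by
        ext y
        constructor
        · rintro ⟨⟨q, t⟩, ⟨hq, ht⟩, rfl⟩
          obtain ⟨x, rfl⟩ := QuotientGroup.mk_surjective q
          exact ⟨x, t, hq, ht, hΦc i x t⟩
        · rintro ⟨x, t, hx, ht, rfl⟩
          exact ⟨(QuotientGroup.mk x, t), ⟨hx, ht⟩, hΦc i x t⟩
      rw [htube]
      exact hJ V hVm hVU hVreg hVW
  -- ### (4) the index-level Cartan axioms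
  have hnc : ∀ i j : ↥C, i ≠ j → ∀ y : Gqs L v, ¬ ∀ h : Gqs L v, h ∈ (j : Subgroup (Gqs L v)) ↔ y⁻¹ * h * y ∈ (i : Subgroup (Gqs L v)) :=
    fun i j hij => hirr i i.2 j j.2 (fun h => hij (Subtype.ext h))
  have hcov' : ∀ g : Gqs L v, IsRegularElt (g.val : GL (Fin 3) (LocalRing L v)) →
      ∃ i : ↥C, ∃ x : Gqs L v, ∀ h : Gqs L v, h ∈ Subgroup.centralizer ({g} : Set (Gqs L v)) ↔ x⁻¹ * h * x ∈ (i : Subgroup (Gqs L v)) := by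
    intro g hg
    obtain ⟨T, hT, x, hx⟩ := hcov g hg
    exact ⟨⟨T, hT⟩, x, hx⟩
  -- ### (5) the pieces of the measure
  let reg : ∀ i : ↥C, Set ↥(i : Subgroup (Gqs L v)) := fun i => {t | IsRegularElt (((t : Gqs L v)).val : GL (Fin 3) (LocalRing L v))}
  have hregm : ∀ i : ↥C, MeasurableSet (reg i) := fun i =>
    ((isOpen_setOf_isRegularElt_cmDatum_local (L := L) (H := qsForm L) (v := v) w (hns w)).preimage continuous_subtype_val).measurableSet
  have hemb : ∀ i : ↥C, MeasurableEmbedding ((↑) : ↥(i : Subgroup (Gqs L v)) → Gqs L v) :=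
    fun i => MeasurableEmbedding.subtype_coe (isClosed_cartan (hTeq i i.2)).measurableSet
  refine ⟨?_, ?_⟩
  · -- ### (6) the Weyl integration formula, unpacked
    intro f α hf hα hαcl
    have hfm : Measurable f := hf.continuous.measurable
    have hfα : Integrable (fun y => f y * α y) νG :=
      (hf.continuous.mul hα).integrable_of_hasCompactSupport hf.hasCompactSupport.mul_right
    have hWIF := integral_mul_classFun_eq_sum_classOrbitalIntegral_of_tubeJacobians (ι := ↥C) (T := fun i : ↥C => (i : Subgroup (Gqs L v)))
      (γ := fun i : ↥C => γ₀ i i.2) (fun i => hγ₀ i i.2) (fun i => hTeq i i.2) hnc hcov' hns νG Φc hΦc hcan tT htc D hD hJac f α hfm hαcl hfα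
    rw [hWIF, plainCartanMeasure_def]
    have hint : ∀ i : ↥C, Integrable (fun t : ↥(i : Subgroup (Gqs L v)) =>
        (D i t : ℝ≥0) • (classOrbitalIntegral mG f (ConjClasses.mk (t : Gqs L v)) * α (t : Gqs L v))) ((tT i).restrict (reg i)) := by
      intro i
      obtain ⟨hprod, -⟩ := integral_cartanSet_eq_of_tubeJacobian_local (hγ₀ i i.2) (hTeq i i.2) (Φc i) (hΦc i) hns νG (tT i) (D i) (hD i) (hJac i)
        (fun y => f y * α y) hfα.integrableOn
      have h1 : Integrable (fun t : ↥(i : Subgroup (Gqs L v)) => ∫ q, (fun y => f y * α y) (Φc i (q, t))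
          ∂(quotientMeasure (i : Subgroup (Gqs L v)) (tT i) (isClosed_cartan (hTeq i i.2)) νG))
          (((tT i).restrict (reg i)).withDensity fun t => (D i t : ℝ≥0∞)) := hprod.integral_prod_left
      rw [integrable_withDensity_iff_integrable_smul (hD i)] at h1
      refine h1.congr ?_
      filter_upwards [ae_restrict_mem (hregm i)] with t ht
      have hpt : ∀ q : Gqs L v ⧸ (i : Subgroup (Gqs L v)), f (Φc i (q, t)) * α (Φc i (q, t)) = f (Φc i (q, t)) * α (t : Gqs L v) := by
        intro q
        induction q using QuotientGroup.induction_on with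
        | H x => rw [hΦc i x t, hαcl x (t : Gqs L v) ht]
      simp only [hpt, integral_mul_const]
      rw [classOrbitalIntegral_mk_eq_integral_conjFamily_cartan (hγ₀ i i.2) (hTeq i i.2) νG hcan (tT i) (htc i) (Φc i) (hΦc i) t ht f hfm]
    rw [integral_finsetSum_measure fun i _ => ?_]
    · refine Finset.sum_congr rfl fun i _ => ?_
      rw [integral_smul_nnreal_measure, (hemb i).integral_map, integral_withDensity_eq_integral_smul (hD i)]
      rw [NNReal.smul_def, NNReal.coe_inv, NNReal.coe_natCast]
      congr 1
      refine integral_congr_ae (Filter.Eventually.of_forall fun t => ?_)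
      simp only [NNReal.smul_def, mul_comm (α (t : Gqs L v))]
    · refine Integrable.smul_measure_nnreal ?_
      rw [(hemb i).integrable_map_iff, integrable_withDensity_iff_integrable_smul (hD i)]
      exact hint i
  · -- ### (7) carried by the regular set
    rw [ae_iff, plainCartanMeasure_def]
    have hS : MeasurableSet {γ : Gqs L v | ¬ IsRegularElt (γ.val : GL (Fin 3) (LocalRing L v))} :=
      (isOpen_setOf_isRegularElt_cmDatum_local (L := L) (H := qsForm L) (v := v) w (hns w)).measurableSet.compl
    rw [Measure.finsetSum_apply]
    refine Finset.sum_eq_zero fun i _ => ?_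
    rw [Measure.smul_apply, smul_eq_zero]
    refine Or.inr ?_
    rw [Measure.map_apply (hemb i).measurable hS]
    refine withDensity_absolutelyContinuous _ _ ?_
    rw [Measure.restrict_apply ((hemb i).measurable hS)]
    have hempty : ((↑) : ↥(i : Subgroup (Gqs L v)) → Gqs L v) ⁻¹' {γ : Gqs L v | ¬ IsRegularElt (γ.val : GL (Fin 3) (LocalRing L v))} ∩ reg i = ∅ :=
      Set.eq_empty_of_forall_notMem fun t ht => ht.1 ht.2
    rw [hempty, measure_empty]

/-! ## §3 The stable Cartan measure: the plain one reweighted by `n(γ)⁻¹` -/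

/-- **THE STABLE CARTAN MEASURE `ρ(C, tT, n) = n⁻¹ · ρ₀(C, tT)`** — the plain Cartan measure with density `n(γ)⁻¹`, `n(γ)` = the number of conjugacy classes in the stable class of `γ`
(`= |𝔇(T_γ∕F)|`: 1, 4, 2, 1 on the Cartans of types (0)–(3), §3.6; a BINDER here, pinned by the stable-transport dictionary of the (B2-S) head).  On it the head proves
★ `IsStableWeylMeasure` (print p. 182 second display: `Σ_{T stable} |Ω_F(T,G)|⁻¹ ∫_T D_G² Φ^{st} α` — the same measure, since `Σ_{T′ ∼_{st} T} |Ω_F(T)|∕|W(T′)| = |𝔇(T∕F)|`), and p03's T-WIF head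
is stated (S4-R25 (3)). [cite: Rogawski1990, §12.5 pp. 182, 186; §3.6 pp. 28–31] -/
def stableCartanMeasure [MeasurableSpace (Gqs L v)] (C : Finset (Subgroup (Gqs L v))) (tT : ∀ i : ↥C, Measure ↥(i : Subgroup (Gqs L v))) (n : Gqs L v → ℕ) :
    Measure (Gqs L v) :=
  (plainCartanMeasure L v C tT).withDensity fun γ => ((n γ : ℝ≥0∞))⁻¹

/-- Unfolding of `stableCartanMeasure` (`rfl`). [cite: Rogawski1990, §12.5 p. 182] -/
theorem stableCartanMeasure_def [MeasurableSpace (Gqs L v)] (C : Finset (Subgroup (Gqs L v))) (tT : ∀ i : ↥C, Measure ↥(i : Subgroup (Gqs L v))) (n : Gqs L v → ℕ) :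
    stableCartanMeasure L v C tT n = (plainCartanMeasure L v C tT).withDensity fun γ => ((n γ : ℝ≥0∞))⁻¹ := rfl

/-- The stable Cartan measure is absolutely continuous with respect to the plain one; in particular it is carried by the regular set whenever the plain one is.
[cite: Rogawski1990, §12.5 p. 182] -/
theorem stableCartanMeasure_absolutelyContinuous [MeasurableSpace (Gqs L v)] (C : Finset (Subgroup (Gqs L v))) (tT : ∀ i : ↥C, Measure ↥(i : Subgroup (Gqs L v)))
    (n : Gqs L v → ℕ) : stableCartanMeasure L v C tT n ≪ plainCartanMeasure L v C tT :=
  withDensity_absolutelyContinuous _ _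

/-! ## §4 The data exist: ★ `exists_isPlainWeylMeasure` from the named term -/

/-- **The Cartan data exist** (★ CARTAN-ALL `exists_cartanAll_weylShape` + ★ (E3) `exists_haar_cartan_compactCore_eq_one`), so the named plain Cartan measure realises ★ p863297's existential:
`∃ C tT, IsPlainWeylMeasure … (plainCartanMeasure L v C tT) ∧ ∀ᵐ reg` — with the Haar letters of `tT` recorded for the downstream heads. [cite: Rogawski1990, §12.5 p. 182; §3.6 pp. 28–31] -/
theorem exists_cartanData_isPlainWeylMeasure (hns : ∀ w : PlacesOver L v, IsCMField.complexConj L • w.1 = w.1)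
    [MeasurableSpace (Gqs L v)] [BorelSpace (Gqs L v)]
    [∀ γ' : Gqs L v, MeasurableSpace (Gqs L v ⧸ Subgroup.centralizer ({γ'} : Set (Gqs L v)))]
    [∀ γ' : Gqs L v, BorelSpace (Gqs L v ⧸ Subgroup.centralizer ({γ'} : Set (Gqs L v)))]
    (νG : Measure (Gqs L v)) [νG.IsHaarMeasure] [νG.IsMulRightInvariant]
    (mG : OrbitalMeasureFamily (Gqs L v)) (hcan : mG.IsCanonical (fun γ : Gqs L v => IsRegularElt (γ.val : GL (Fin 3) (LocalRing L v))) νG) :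
    ∃ (C : Finset (Subgroup (Gqs L v))) (tT : ∀ i : ↥C, Measure ↥(i : Subgroup (Gqs L v))),
      (cmBorelTriple L 3 v).M ∈ C ∧
      (∀ T ∈ C, ∃ γ₀ : Gqs L v, IsRegularElt (γ₀.val : GL (Fin 3) (LocalRing L v)) ∧ T = Subgroup.centralizer ({γ₀} : Set (Gqs L v))) ∧
      (∀ T ∈ C, T ≠ (cmBorelTriple L 3 v).M → IsCompact (T : Set (Gqs L v))) ∧
      (∀ γ : Gqs L v, IsRegularElt (γ.val : GL (Fin 3) (LocalRing L v)) →
        ∃ T ∈ C, ∃ x : Gqs L v, ∀ g : Gqs L v, g ∈ Subgroup.centralizer ({γ} : Set (Gqs L v)) ↔ x⁻¹ * g * x ∈ T) ∧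
      (∀ T ∈ C, ∀ T' ∈ C, T ≠ T' → ∀ y : Gqs L v, ¬ ∀ h : Gqs L v, h ∈ T' ↔ y⁻¹ * h * y ∈ T) ∧
      (∀ i : ↥C, (tT i).IsHaarMeasure) ∧ (∀ i : ↥C, (tT i).IsInvInvariant) ∧ (∀ i : ↥C, tT i (compactCore ↥(i : Subgroup (Gqs L v))) = 1) ∧
      IsPlainWeylMeasure L (R90.S4.splitFormGL L) v νG mG (plainCartanMeasure L v C tT) ∧
      ∀ᵐ γ ∂(plainCartanMeasure L v C tT), IsRegularElt (γ.val : GL (Fin 3) (LocalRing L v)) := by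
  obtain ⟨C, hM, hZ, hcpt, hcov, hirr⟩ := F0P3cStCharTSCartanAll.exists_cartanAll_weylShape L v hns
  have hex : ∀ i : ↥C, ∃ tT : Measure ↥(i : Subgroup (Gqs L v)), tT.IsHaarMeasure ∧ tT.IsInvInvariant ∧ tT (compactCore ↥(i : Subgroup (Gqs L v))) = 1 := by
    intro i
    obtain ⟨γ₀, hγ₀, hT⟩ := hZ i i.2
    exact exists_haar_cartan_compactCore_eq_one hγ₀ hT
  choose tT htH htI htc using hex
  exact ⟨C, tT, hM, hZ, hcpt, hcov, hirr, htH, htI, htc,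
    isPlainWeylMeasure_plainCartanMeasure L v hns hZ hcpt hcov hirr νG mG hcan tT htH htI htc⟩

end CartanMeasures

end Summit.HodgeConjecture.HodgeConjecture.R90.S4

end
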